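import Summits.NavierStokesRegularity.NavierStokesRegularity.Theses.FilamentSkeletonRss

/-!
# `SkeletonEquilibrium` (stmt-NavierStokesRegularity-15400): straight skeletons are vertical, hence never supercritical

Negative-side support for the crux `FilamentSkeletonRss.SkeletonEquilibrium`, from the cdisprove work
file `Cruxes/SkeletonEquilibrium/Disproof.lean` §(c) (seat
refuter-cdisprove-stmt-NavierStokesRegularity-15400-0, 2026-08-16). A refutation of the NATURAL
STRENGTHENING "the skeleton may be taken to consist of straight filaments" — i.e. of the hope that the
route's certified INNER configurations (the 2001 chiral `C₃` skew triple and 7-line cages, the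
ideators' exact `C₄`/`C₃` rational data) are themselves witnesses at some `Γ`:

* `norm_line_induction_le` — the regularised Biot–Savart induction of one straight filament
  `σ ↦ a + σe` (`‖e‖ = 1`) is bounded by `π` at EVERY point of space (the crux's integrand along a
  line is the scalar Rosenhead kernel times the constant vector `e × (x − a)`; the kernel integrates to
  `≤ π/√(dist² + 1)` by the pointwise bound `((A+s²)^{3/2})⁻¹ ≤ A^{-1/2}(1+s²)⁻¹`, `A ≥ 1`, and
  `∫ (1+s²)⁻¹ = π`).
* `straight_lines_vertical` — if all filaments are affine lines and the relative-equilibrium system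
  of the crux holds with `α ≠ 0`, then every line is VERTICAL (`e₃ × e_j = 0`): along a non-vertical
  line the frame rotation `−α e₃ × Ξ_j(τ)` has the normal component `−ατ e₃ × e_j`, growing without
  bound, while the induction is bounded by `Σ_k |Γγ_k/4π|·π` and the Leray drift's normal part is
  constant — the `(e₃ × e_j)`-component of the identity, `ατ‖e₃ × e_j‖² = ⟪u, e₃ × e_j⟫ + const`, is
  absurd for large `τ`.
* `straight_lines_slope_half`, `straight_lines_not_supercritical` — consequently (vertical lines
  induce horizontal velocities; `e₃`-component of the identity) every slip is `w_j = ½(±⟪a_j,e₃⟫ + τ)`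
  with slope EXACTLY `½`, and no supercritical clause `c + δ ≤ w_j′(τ*)` with `c ≥ ½`, `δ > 0` can
  hold — the crux's is `c = 3/2`. Together with the landed
  `CoreGluing.Negative.parallel_lines_not_supercritical` (the vertical case) this closes the class of
  straight configurations: ANY witness of `SkeletonEquilibrium` is genuinely curved, and the (SC)
  margin certified on straight inner data must survive the bending to log-spiral ends (the actual
  content of the crux).
-/

set_option linter.dupNamespace false

namespace Summit.NavierStokesRegularity.NavierStokesRegularity.Theorems.SkeletonEquilibrium.Negative

open Literature.Analysis.FluidPDE MeasureTheory Real Filter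
open scoped RealInnerProductSpace InnerProductSpace BigOperators

/-- `‖v × w‖ ≤ ‖v‖ ‖w‖`. [folklore] -/
private theorem norm_cross_le (v w : EuclideanSpace ℝ (Fin 3)) : ‖cross v w‖ ≤ ‖v‖ * ‖w‖ := by
  rw [norm_cross]
  exact mul_le_of_le_one_right (by positivity) (Real.sin_le_one _)

/-- `v × v = 0` (private copy; the tree survivors sit behind unrelated imports). [folklore] -/
private theorem cross_self' (v : EuclideanSpace ℝ (Fin 3)) : cross v v = 0 := by simp [cross]

/-- Linearity of `a × ·` in scalars. [folklore] -/
private theorem cross_smul_right' (a : EuclideanSpace ℝ (Fin 3)) (r : ℝ) (v : EuclideanSpace ℝ (Fin 3)) :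
    cross a (r • v) = r • cross a v := by
  rw [← crossCLM_apply, map_smul, crossCLM_apply]

/-- Additivity of `a × ·`. [folklore] -/
private theorem cross_add_right' (a u v : EuclideanSpace ℝ (Fin 3)) :
    cross a (u + v) = cross a u + cross a v := by
  rw [← crossCLM_apply, map_add, crossCLM_apply, crossCLM_apply]

/-- `a × (u − v) = a × u − a × v`. [folklore] -/
private theorem cross_sub_right' (a u v : EuclideanSpace ℝ (Fin 3)) :
    cross a (u - v) = cross a u - cross a v := by
  rw [← crossCLM_apply, map_sub, crossCLM_apply, crossCLM_apply]

/-- `⟪a × b, b⟫ = 0`. [folklore] -/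
private theorem inner_cross_self_right' (a b : EuclideanSpace ℝ (Fin 3)) : ⟪cross a b, b⟫ = 0 := by
  simp only [cross, PiLp.inner_apply, RCLike.inner_apply, conj_trivial, Fin.sum_univ_three,
    cross_apply, Matrix.cons_val_zero, Matrix.cons_val_one, Matrix.cons_val_two,
    Matrix.head_cons, Matrix.tail_cons]
  ring

/-- The kernel factor: for `A ≥ 1`, `((A + s²)^{3/2})⁻¹ ≤ (√A)⁻¹ (1 + s²)⁻¹`. [folklore] -/
private theorem kernel_factor_le {A : ℝ} (hA : 1 ≤ A) (s : ℝ) :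
    ((A + s ^ 2) ^ (3 / 2 : ℝ))⁻¹ ≤ (Real.sqrt A)⁻¹ * (1 + s ^ 2)⁻¹ := by
  have hAs : 0 < A + s ^ 2 := by positivity
  have hsqA : 0 < Real.sqrt A := Real.sqrt_pos.mpr (by linarith)
  have h1s : 0 < 1 + s ^ 2 := by positivity
  have hsplit : (A + s ^ 2) ^ (3 / 2 : ℝ) = (A + s ^ 2) * Real.sqrt (A + s ^ 2) := by
    rw [show (3 / 2 : ℝ) = 1 + 1 / 2 by norm_num, Real.rpow_add hAs, Real.rpow_one, Real.sqrt_eq_rpow]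
  rw [hsplit, ← mul_inv]
  apply inv_anti₀ (by positivity)
  have h2 : Real.sqrt A ≤ Real.sqrt (A + s ^ 2) := Real.sqrt_le_sqrt (by nlinarith [sq_nonneg s])
  have h3 : 1 + s ^ 2 ≤ A + s ^ 2 := by linarith
  calc Real.sqrt A * (1 + s ^ 2) ≤ Real.sqrt (A + s ^ 2) * (A + s ^ 2) :=
        mul_le_mul h2 h3 h1s.le (Real.sqrt_nonneg _)
    _ = (A + s ^ 2) * Real.sqrt (A + s ^ 2) := mul_comm _ _

/-- Pythagoras along a unit direction: `‖d − σe‖² = ‖d − ⟪d,e⟫e‖² + (σ − ⟪d,e⟫)²`. [folklore] -/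
private theorem norm_sub_smul_sq (d e : EuclideanSpace ℝ (Fin 3)) (he : ‖e‖ = 1) (σ : ℝ) :
    ‖d - σ • e‖ ^ 2 = ‖d - ⟪d, e⟫ • e‖ ^ 2 + (σ - ⟪d, e⟫) ^ 2 := by
  rw [norm_sub_sq_real, norm_sub_sq_real, real_inner_smul_right, real_inner_smul_right, norm_smul,
    norm_smul, he, mul_one, mul_one, Real.norm_eq_abs, Real.norm_eq_abs, sq_abs, sq_abs]
  ring

/-- The regularised line kernel integrates to at most `π / √(dist² + 1)` (`dist` = distance of the
point from the line). [folklore] -/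
private theorem integral_kernel_le (d e : EuclideanSpace ℝ (Fin 3)) (he : ‖e‖ = 1) :
    ∫ σ : ℝ, ((‖d - σ • e‖ ^ 2 + 1) ^ (3 / 2 : ℝ))⁻¹ ≤
      π / Real.sqrt (‖d - ⟪d, e⟫ • e‖ ^ 2 + 1) := by
  set A := ‖d - ⟪d, e⟫ • e‖ ^ 2 + 1 with hAdef
  have hA : 1 ≤ A := by rw [hAdef]; nlinarith [sq_nonneg ‖d - ⟪d, e⟫ • e‖]
  have hpt : ∀ σ, ((‖d - σ • e‖ ^ 2 + 1) ^ (3 / 2 : ℝ))⁻¹ ≤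
      (Real.sqrt A)⁻¹ * (1 + (σ - ⟪d, e⟫) ^ 2)⁻¹ := by
    intro σ
    rw [norm_sub_smul_sq d e he σ,
      show ‖d - ⟪d, e⟫ • e‖ ^ 2 + (σ - ⟪d, e⟫) ^ 2 + 1 = A + (σ - ⟪d, e⟫) ^ 2 by rw [hAdef]; ring]
    exact kernel_factor_le hA _
  have hg : Integrable (fun σ : ℝ => (Real.sqrt A)⁻¹ * (1 + (σ - ⟪d, e⟫) ^ 2)⁻¹) :=
    (integrable_inv_one_add_sq.comp_sub_right ⟪d, e⟫).const_mul _
  have hshift : ∫ σ : ℝ, (1 + (σ - ⟪d, e⟫) ^ 2)⁻¹ = π := by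
    have h := integral_sub_right_eq_self (μ := (volume : Measure ℝ)) (fun σ : ℝ => (1 + σ ^ 2)⁻¹) ⟪d, e⟫
    rw [h, integral_univ_inv_one_add_sq]
  calc ∫ σ : ℝ, ((‖d - σ • e‖ ^ 2 + 1) ^ (3 / 2 : ℝ))⁻¹
      ≤ ∫ σ : ℝ, (Real.sqrt A)⁻¹ * (1 + (σ - ⟪d, e⟫) ^ 2)⁻¹ :=
        integral_mono_of_nonneg (Eventually.of_forall fun σ => by positivity) hg
          (Eventually.of_forall hpt)
    _ = (Real.sqrt A)⁻¹ * π := by rw [integral_const_mul, hshift]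
    _ = π / Real.sqrt A := by rw [inv_mul_eq_div]

/-- Along a straight source line `a + σ e` the crux's integrand at `x` is the scalar kernel times the
constant vector `e × (x − a)`. [folklore] -/
private theorem line_integrand (a e x : EuclideanSpace ℝ (Fin 3)) (σ : ℝ) :
    ((‖x - (a + σ • e)‖ ^ 2 + 1) ^ (3 / 2 : ℝ))⁻¹ • cross e (x - (a + σ • e)) =
      ((‖(x - a) - σ • e‖ ^ 2 + 1) ^ (3 / 2 : ℝ))⁻¹ • cross e (x - a) := by
  rw [sub_add_eq_sub_sub, cross_sub_right', cross_smul_right', cross_self', smul_zero, sub_zero]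

/-- **Uniform bound on the regularised induction of a straight filament**: at EVERY point of space,
`‖∫ ((‖x − (a+σe)‖²+1)^{3/2})⁻¹ e × (x − (a+σe)) dσ‖ ≤ π` (the regularised line vortex
`2 e × d⊥/(‖d⊥‖²+1)` has speed at most `1`; here with the crude constant `π`). [folklore] -/
theorem norm_line_induction_le (a e x : EuclideanSpace ℝ (Fin 3)) (he : ‖e‖ = 1) :
    ‖∫ σ : ℝ, ((‖x - (a + σ • e)‖ ^ 2 + 1) ^ (3 / 2 : ℝ))⁻¹ • cross e (x - (a + σ • e))‖ ≤ π := by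
  simp_rw [line_integrand]
  rw [integral_smul_const, norm_smul, Real.norm_eq_abs,
    abs_of_nonneg (integral_nonneg fun σ => by positivity)]
  set d := x - a with hd
  have hcr : cross e (d - ⟪d, e⟫ • e) = cross e d := by
    rw [cross_sub_right' e d (⟪d, e⟫ • e), cross_smul_right', cross_self', smul_zero, sub_zero]
  have hle1 : ‖cross e d‖ ≤ ‖d - ⟪d, e⟫ • e‖ := by
    calc ‖cross e d‖ = ‖cross e (d - ⟪d, e⟫ • e)‖ := by rw [hcr]
      _ ≤ ‖e‖ * ‖d - ⟪d, e⟫ • e‖ := norm_cross_le _ _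
      _ = _ := by rw [he, one_mul]
  have hI := integral_kernel_le d e he
  set B := ‖d - ⟪d, e⟫ • e‖ with hB
  have hBs : 0 < Real.sqrt (B ^ 2 + 1) := Real.sqrt_pos.mpr (by positivity)
  have hsq : B ≤ Real.sqrt (B ^ 2 + 1) := by
    rw [Real.le_sqrt (norm_nonneg _) (by positivity)]
    linarith
  calc (∫ σ : ℝ, ((‖d - σ • e‖ ^ 2 + 1) ^ (3 / 2 : ℝ))⁻¹) * ‖cross e d‖
      ≤ (π / Real.sqrt (B ^ 2 + 1)) * B := mul_le_mul hI hle1 (norm_nonneg _) (by positivity)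
    _ = π * B / Real.sqrt (B ^ 2 + 1) := by ring
    _ ≤ π := by
        rw [div_le_iff₀ hBs]
        exact mul_le_mul_of_nonneg_left hsq Real.pi_pos.le

/-- **Straight filaments in relative equilibrium are vertical.** Let every filament of a
configuration be an affine line, `Ξ_k(τ) = a_k + τ e_k` with `‖e_k‖ = 1` (any number `N`, positions,
directions, circulation ratios `γ_k`, circulation `Γ`), and let the relative-equilibrium system of
`SkeletonEquilibrium` hold with some slips `w_j` and angular speed `α ≠ 0`. Then every direction is
vertical: `e₃ × e_j = 0`. Reason: the regularised induction of straight filaments is bounded by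
`Σ_k |Γγ_k/4π|·π` UNIFORMLY in space (`norm_line_induction_le`), the Leray drift `½Ξ_j` has normal
component `½(a_j)⊥` (bounded), but the frame rotation `−α e₃ × Ξ_j(τ)` has the normal component
`−ατ e₃ × e_j`, unbounded along the line unless `e₃ × e_j = 0`. So the certified INNER skew-line
configurations of the route (C₃ triple, cages, the ideators' C₄/C₃ data) are never themselves
witnesses at any `Γ`: bending (the outer log-spiral ends) is mandatory. [folklore] -/
theorem straight_lines_vertical {N : ℕ} (γ : Fin N → ℝ) {α : ℝ} (hα : α ≠ 0) (Γ : ℝ)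
    (a e : Fin N → EuclideanSpace ℝ (Fin 3)) (he : ∀ k, ‖e k‖ = 1)
    (Ξ : Fin N → ℝ → EuclideanSpace ℝ (Fin 3)) (hΞ : ∀ k, Ξ k = fun τ => a k + τ • e k)
    (w : Fin N → ℝ → ℝ)
    (heq : ∀ j τ, (∑ k : Fin N, (Γ * γ k / (4 * Real.pi)) • ∫ σ : ℝ,
      ((‖Ξ j τ - Ξ k σ‖ ^ 2 + 1) ^ (3 / 2 : ℝ))⁻¹ • cross (deriv (Ξ k) σ) (Ξ j τ - Ξ k σ)) +
      (1 / 2 : ℝ) • Ξ j τ - α • cross (EuclideanSpace.single (2 : Fin 3) (1 : ℝ)) (Ξ j τ) =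
      w j τ • deriv (Ξ j) τ)
    (j : Fin N) : cross (EuclideanSpace.single (2 : Fin 3) (1 : ℝ)) (e j) = 0 := by
  set e₃ : EuclideanSpace ℝ (Fin 3) := EuclideanSpace.single (2 : Fin 3) (1 : ℝ) with he₃
  have hderiv : ∀ k σ, deriv (Ξ k) σ = e k := by
    intro k σ
    rw [hΞ k, deriv_const_add, deriv_smul_const differentiableAt_id, deriv_id'', one_smul]
  -- the induced velocity along filament j and its uniform bound
  set S : ℝ → EuclideanSpace ℝ (Fin 3) := fun τ => ∑ k : Fin N, (Γ * γ k / (4 * Real.pi)) •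
    ∫ σ : ℝ, ((‖Ξ j τ - Ξ k σ‖ ^ 2 + 1) ^ (3 / 2 : ℝ))⁻¹ • cross (deriv (Ξ k) σ) (Ξ j τ - Ξ k σ)
    with hSdef
  set M : ℝ := ∑ k : Fin N, |Γ * γ k / (4 * Real.pi)| * π with hM
  have hS : ∀ τ, ‖S τ‖ ≤ M := by
    intro τ
    simp only [hSdef]
    refine (norm_sum_le _ _).trans (Finset.sum_le_sum fun k _ => ?_)
    rw [norm_smul, Real.norm_eq_abs]
    refine mul_le_mul_of_nonneg_left ?_ (abs_nonneg _)
    have hfun : (fun σ => ((‖Ξ j τ - Ξ k σ‖ ^ 2 + 1) ^ (3 / 2 : ℝ))⁻¹ •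
        cross (deriv (Ξ k) σ) (Ξ j τ - Ξ k σ)) = fun σ => ((‖Ξ j τ - (a k + σ • e k)‖ ^ 2 + 1) ^
        (3 / 2 : ℝ))⁻¹ • cross (e k) (Ξ j τ - (a k + σ • e k)) := by
      funext σ; rw [hderiv k σ, hΞ k]
    rw [hfun]
    exact norm_line_induction_le (a k) (e k) (Ξ j τ) (he k)
  -- the normal direction n = e₃ × e_j
  set n : EuclideanSpace ℝ (Fin 3) := cross e₃ (e j) with hn
  by_contra hne
  have hnpos : 0 < ‖n‖ := norm_pos_iff.mpr hne
  have hen : ⟪e j, n⟫ = 0 := by rw [hn, real_inner_comm, inner_cross_self_right']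
  have hnn : ⟪cross e₃ (e j), n⟫ = ‖n‖ ^ 2 := by rw [← hn, real_inner_self_eq_norm_sq]
  -- the n-component of the equilibrium identity: α τ ‖n‖² = ⟪S τ, n⟫ + K₀
  set K₀ : ℝ := (1 / 2 : ℝ) * ⟪a j, n⟫ - α * ⟪cross e₃ (a j), n⟫ with hK₀
  have key : ∀ τ, α * τ * ‖n‖ ^ 2 = ⟪S τ, n⟫ + K₀ := by
    intro τ
    have h := congrArg (fun v => ⟪v, n⟫) (heq j τ)
    have hΞj : Ξ j τ = a j + τ • e j := by rw [hΞ j]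
    rw [hderiv j τ, real_inner_smul_left, hen, mul_zero] at h
    -- h : ⟪S τ + ½ Ξ_j τ − α e₃ × Ξ_j τ, n⟫ = 0, with S τ folded
    change ⟪S τ + (1 / 2 : ℝ) • Ξ j τ - α • cross e₃ (Ξ j τ), n⟫ = 0 at h
    rw [hΞj, cross_add_right', cross_smul_right', inner_sub_left, inner_add_left, inner_smul_left,
      inner_smul_left, inner_add_left, inner_add_left, inner_smul_left, inner_smul_left, hen, hnn] at h
    simp only [conj_trivial] at h
    rw [hK₀]
    linarith
  -- evaluate at a τ that makes the left side exceed every bound of the right side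
  set τ₀ : ℝ := (M * ‖n‖ + |K₀| + 1) / (α * ‖n‖ ^ 2) with hτ₀
  have h1 : α * τ₀ * ‖n‖ ^ 2 = M * ‖n‖ + |K₀| + 1 := by
    rw [hτ₀]
    field_simp
  have h2 := key τ₀
  have h3 : ⟪S τ₀, n⟫ ≤ M * ‖n‖ :=
    (real_inner_le_norm _ _).trans (mul_le_mul_of_nonneg_right (hS τ₀) (norm_nonneg _))
  have h4 : K₀ ≤ |K₀| := le_abs_self _
  linarith

/-- `e₃ × v = 0` forces `v` vertical: `v = (v 2) • e₃`. [folklore] -/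
private theorem eq_smul_single_of_cross_eq_zero {v : EuclideanSpace ℝ (Fin 3)}
    (h : cross (EuclideanSpace.single (2 : Fin 3) (1 : ℝ)) v = 0) :
    v = (v 2) • EuclideanSpace.single (2 : Fin 3) (1 : ℝ) := by
  have h0 : v 1 = 0 := by
    have := congrArg (fun u => u 0) h
    simpa [cross, cross_apply] using this
  have h1 : v 0 = 0 := by
    have := congrArg (fun u => u 1) h
    simpa [cross, cross_apply] using this
  ext i
  fin_cases i <;> simp [h0, h1]

/-- The `e₃`-component of the induction of a VERTICAL filament vanishes. [folklore] -/
private theorem inner_cross_vertical_e3 (c : ℝ) (u : EuclideanSpace ℝ (Fin 3)) :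
    ⟪cross (c • EuclideanSpace.single (2 : Fin 3) (1 : ℝ)) u,
      EuclideanSpace.single (2 : Fin 3) (1 : ℝ)⟫ = 0 := by
  simp [cross, cross_apply, EuclideanSpace.inner_single_right]

/-- **No straight witness of the crux at any supercritical threshold.** With all filaments affine
lines (as in `straight_lines_vertical`) and `α ≠ 0`, every slip has slope EXACTLY the Leray rate:
`w_j′ ≡ ½`. (By `straight_lines_vertical` all lines are vertical, `e_j = ±e₃`; then the induction and
the rotation are horizontal and the `e₃`-component of the identity reads `w_j = ½(±⟪a_j,e₃⟫ + τ)`.)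
Hence the supercritical clause `c + δ ≤ w_j′(τ*)` fails for every `c ≥ ½`, `δ > 0` — in particular
the crux's `3/2 + δ`: straight-line (inner) configurations are never witnesses; any witness is
genuinely curved. [folklore] -/
theorem straight_lines_slope_half {N : ℕ} (γ : Fin N → ℝ) {α : ℝ} (hα : α ≠ 0) (Γ : ℝ)
    (a e : Fin N → EuclideanSpace ℝ (Fin 3)) (he : ∀ k, ‖e k‖ = 1)
    (Ξ : Fin N → ℝ → EuclideanSpace ℝ (Fin 3)) (hΞ : ∀ k, Ξ k = fun τ => a k + τ • e k)
    (w : Fin N → ℝ → ℝ)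
    (heq : ∀ j τ, (∑ k : Fin N, (Γ * γ k / (4 * Real.pi)) • ∫ σ : ℝ,
      ((‖Ξ j τ - Ξ k σ‖ ^ 2 + 1) ^ (3 / 2 : ℝ))⁻¹ • cross (deriv (Ξ k) σ) (Ξ j τ - Ξ k σ)) +
      (1 / 2 : ℝ) • Ξ j τ - α • cross (EuclideanSpace.single (2 : Fin 3) (1 : ℝ)) (Ξ j τ) =
      w j τ • deriv (Ξ j) τ)
    (j : Fin N) (τ : ℝ) : deriv (w j) τ = 1 / 2 := by
  set e₃ : EuclideanSpace ℝ (Fin 3) := EuclideanSpace.single (2 : Fin 3) (1 : ℝ) with he₃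
  have hvert : ∀ k, e k = (e k 2) • e₃ := fun k =>
    eq_smul_single_of_cross_eq_zero (straight_lines_vertical γ hα Γ a e he Ξ hΞ w heq k)
  have hne₃ : ‖e₃‖ = 1 := by simp [he₃]
  have hsq : ∀ k, (e k 2) ^ 2 = 1 := by
    intro k
    have h := he k
    rw [hvert k, norm_smul, Real.norm_eq_abs, hne₃, mul_one] at h
    rw [← sq_abs, h, one_pow]
  have hderiv : ∀ k σ, deriv (Ξ k) σ = e k := by
    intro k σ
    rw [hΞ k, deriv_const_add, deriv_smul_const differentiableAt_id, deriv_id'', one_smul]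
  have hunit : ⟪e₃, e₃⟫ = 1 := by simp [he₃]
  have hperp : ∀ v : EuclideanSpace ℝ (Fin 3), ⟪cross e₃ v, e₃⟫ = 0 := by
    intro v; simpa using inner_cross_vertical_e3 1 v
  have hperpk : ∀ (k : Fin N) (u : EuclideanSpace ℝ (Fin 3)), ⟪e₃, cross (e k) u⟫ = 0 := by
    intro k u
    rw [hvert k, real_inner_comm]
    exact inner_cross_vertical_e3 _ _
  -- the e₃-component of the identity along filament j: w_j σ' = ½(⟪a_j,e₃⟫ (e j 2) + σ')·...
  have hw : ∀ σ' : ℝ, w j σ' = (1 / 2) * ((e j 2) * ⟪a j, e₃⟫ + σ') := by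
    intro σ'
    have hint : ∀ k, ⟪(∫ σ : ℝ, ((‖Ξ j σ' - Ξ k σ‖ ^ 2 + 1) ^ (3 / 2 : ℝ))⁻¹ •
        cross (deriv (Ξ k) σ) (Ξ j σ' - Ξ k σ)), e₃⟫ = 0 := by
      intro k
      by_cases hI : Integrable (fun σ : ℝ => ((‖Ξ j σ' - Ξ k σ‖ ^ 2 + 1) ^ (3 / 2 : ℝ))⁻¹ •
          cross (deriv (Ξ k) σ) (Ξ j σ' - Ξ k σ))
      · rw [real_inner_comm, ← integral_inner hI]
        simp_rw [real_inner_smul_right, hderiv k, hperpk, mul_zero, integral_zero]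
      · rw [integral_undef hI, inner_zero_left]
    have key := congrArg (fun v => ⟪v, e₃⟫) (heq j σ')
    rw [hderiv j] at key
    simp only [inner_sub_left, inner_add_left, sum_inner, real_inner_smul_left, hint, mul_zero,
      Finset.sum_const_zero, zero_add, hperp, sub_zero] at key
    have hΞj : Ξ j σ' = a j + σ' • e j := by rw [hΞ j]
    rw [hΞj, inner_add_left, real_inner_smul_left, hvert j, real_inner_smul_left, hunit, mul_one]
      at key
    -- key : ½ (⟪a j, e₃⟫ + σ' * e j 2) = w j σ' * e j 2
    have h2 := hsq j
    have : w j σ' = w j σ' * (e j 2) ^ 2 := by rw [h2, mul_one]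
    rw [this]
    linear_combination (-(e j 2)) * key + (1 / 2 : ℝ) * σ' * h2
  have hfun : w j = fun σ' => (1 / 2) * ((e j 2) * ⟪a j, e₃⟫ + σ') := funext hw
  rw [hfun, deriv_const_mul _ ((differentiableAt_const _).add differentiableAt_id), deriv_const_add,
    deriv_id'', mul_one]

/-- Hence a straight configuration never meets a supercritical clause `c + δ ≤ w_j′(τ*)` with
`c ≥ ½`, `δ > 0` (the crux: `c = 3/2`). [folklore] -/
theorem straight_lines_not_supercritical {N : ℕ} (γ : Fin N → ℝ) {α : ℝ} (hα : α ≠ 0) (Γ : ℝ)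
    {c δ : ℝ} (hc : 1 / 2 ≤ c) (hδ : 0 < δ)
    (a e : Fin N → EuclideanSpace ℝ (Fin 3)) (he : ∀ k, ‖e k‖ = 1)
    (Ξ : Fin N → ℝ → EuclideanSpace ℝ (Fin 3)) (hΞ : ∀ k, Ξ k = fun τ => a k + τ • e k)
    (w : Fin N → ℝ → ℝ)
    (heq : ∀ j τ, (∑ k : Fin N, (Γ * γ k / (4 * Real.pi)) • ∫ σ : ℝ,
      ((‖Ξ j τ - Ξ k σ‖ ^ 2 + 1) ^ (3 / 2 : ℝ))⁻¹ • cross (deriv (Ξ k) σ) (Ξ j τ - Ξ k σ)) +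
      (1 / 2 : ℝ) • Ξ j τ - α • cross (EuclideanSpace.single (2 : Fin 3) (1 : ℝ)) (Ξ j τ) =
      w j τ • deriv (Ξ j) τ)
    (j : Fin N) (τs : ℝ) : ¬ (c + δ ≤ deriv (w j) τs) := by
  rw [straight_lines_slope_half γ hα Γ a e he Ξ hΞ w heq j τs]
  linarith

end Summit.NavierStokesRegularity.NavierStokesRegularity.Theorems.SkeletonEquilibrium.Negative
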